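import Summits.NavierStokesRegularity.OSWSelfSimilar.SheetNSLineTorusCascade
import HarnessLib

/-!
# Viscous CLM on the torus (`a = 0`, `σ = 2`): the STATIONARY periodised Schochet pole is a super-solution —
# `c_k(t) ≤ 12ν k (c/(12ν))^k` for all `t`, hence GLOBAL for `c < 12ν`

HONEST FRAMING (cell ns-blowup GROUP B «PROFILE SEARCH», zone Z3, row Z3-U addendum A-F2 of `HOME/profile/z3/CENSUS-Z3.md`;
human rulings D-0035/D-0074): **1-D MODEL (viscous Constantin–Lax–Majda equation `ω_t = ω Hω + ν ω_xx` on `𝕋 = ℝ/2πℤ`);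
ODE calculus on Fourier-coefficient families, kernel-checked; not Euler, not Navier–Stokes; «violates: none — MODEL».**

OBJECT: the sine-datum cascade `IsSineCascade ν c e` of `SheetNSLineTorusCascade` (`ċ_k = ½ Σ_{i+j=k} c_i c_j − ν k² c_k`,
`c_1(0) = c ≥ 0`, `c_k(0) = 0` for `k ≥ 2`). There the RECEDING pole `24ν k (c/(24ν))^k e^{−νkt}` (`−3ν′csc²` with `ν′ = 2ν`)
was a SUB-solution (blow-up for `c ≥ 48ν`); in `SheetNSLineTorusCascadeGlobal` the `σ = 1` cascade was a super-solution (global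
for `c < 2eν`). HERE the sharper and simpler super-solution: the STATIONARY pole `U_k = 12ν k (c/(12ν))^k` (`−3ν csc²` itself,
`ν′ = ν`, fixed in time). By `SheetNSLineSchochetCornerTorus.torusCorner_coeff_identity`, `Σ_{i+j=k} U_i U_j = 24ν²(k³−k)(c/12ν)^k`
`= 2νk²·U_k·(1 − k^{−2}) ≤ 2νk² U_k`, and a TIME-UNIFORM bound propagates through the triangular cascade
(`e^{νk²t} c_k(t) ≤ ∫₀^t e^{νk²s} ½ Σ U_i U_j ds ≤ U_k e^{νk²t}`):

* `mode_le_stationaryPole` — **`c_k(t) ≤ 12ν k (c/(12ν))^k` for every `k`, `t ≥ 0`, every `c ≥ 0`** (no smallness);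
* `partialSum_le_stationaryPole` — **if `c < 12ν` then `Σ_{k≤K} c_k(t) ≤ 144ν²c/(12ν − c)²` for all `K`, `t ≥ 0`** — a uniform
  Wiener-norm bound, hence (pen: `B₀` continuation [cite: AmbroseLushnikovSiegelSilantyev2024, §3]) the solution from
  `ω₀ = −c sin x` is GLOBAL for `c < 12ν`. KERNEL BRACKET of the threshold for sine data: **global for `c < 12ν`, blow-up for
  `c ≥ 48ν`** (companion file); located value `19.7756ν` (cascade numerics, `HOME/profile/z3/SHEET.md` §15). Print: global for
  `‖ω₀‖_{B₀} < ν/4` [cite: SilantyevLushnikovSiegelAmbrose2025, Thm 2.2].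
Remark (pen): the best TIME-UNIFORM super-solution is the minimal solution of `2νk² U_k = Σ_{i+j=k} U_iU_j`, `U_1 = c`, whose
generating function has radius `13.7136…·ν/c` (double pole of `2(w∂_w)²U = U²`) — so no time-uniform bound reaches the threshold.
bears_on: LADDER-NS N5 / zone Z3 (row Z3-U) → N1 linear core. WHAT THIS IS NOT: not NS; no PDE object; not the threshold. No definitions.
-/

namespace Summit.NavierStokesRegularity.OSWSelfSimilar
namespace SheetNSLineTorusCascade

open Finset Real Set

variable {ν c : ℝ} {e : ℕ → ℝ → ℝ}

/-- **The convolution of the stationary pole profile** `U_k = 12ν k q^k`: `Σ_{i+j=k} U_i U_j = 24ν²(k³ − k) q^k`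
(`SheetNSLineSchochetCornerTorus.torusCorner_coeff_identity`). [new here — MODEL] -/
theorem stationaryPole_conv (ν q : ℝ) (k : ℕ) :
    ∑ p ∈ antidiagonal k, (12 * ν * (p.1 : ℝ) * q ^ p.1) * (12 * ν * (p.2 : ℝ) * q ^ p.2)
      = 24 * ν ^ 2 * ((k : ℝ) ^ 3 - k) * q ^ k := by
  have key := SheetNSLineSchochetCornerTorus.torusCorner_coeff_identity ν q k
  linarith

/-- **THE STATIONARY POLE IS A SUPER-SOLUTION (time-uniform bound, no smallness).** For the sine-datum cascade with `ν > 0`,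
`c ≥ 0`: `c_k(t) ≤ 12ν k (c/(12ν))^k` for every `k` and every `t ≥ 0`. [new here — MODEL] -/
theorem mode_le_stationaryPole (he : IsSineCascade ν c e) (hν : 0 < ν) (hc : 0 ≤ c) :
    ∀ k : ℕ, ∀ t : ℝ, 0 ≤ t → e k t ≤ 12 * ν * (k : ℝ) * (c / (12 * ν)) ^ k := by
  have hq0 : 0 ≤ c / (12 * ν) := div_nonneg hc (by positivity)
  intro k
  induction k using Nat.strong_induction_on with
  | _ k ih =>
    intro t ht
    rcases Nat.lt_or_ge k 2 with hk | hk
    · interval_cases k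
      · rw [he.zero]; simp
      · rw [mode_one he t ht]
        have hν0 : ν ≠ 0 := hν.ne'
        have h1 : 12 * ν * ((1 : ℕ) : ℝ) * (c / (12 * ν)) ^ 1 = c := by push_cast; field_simp
        rw [h1]
        have hexp : exp (-(ν * t)) ≤ 1 := exp_le_one_iff.mpr (by nlinarith)
        nlinarith
    · -- k ≥ 2: ψ(s) = D_k(s) − (U*U)_k e^{νk²s}/(2νk²) is non-increasing on [0, ∞)
      set q : ℝ := c / (12 * ν) with hq
      have hk0 : (0 : ℝ) < k := by exact_mod_cast (show 0 < k by omega)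
      set Ck : ℝ := 24 * ν ^ 2 * ((k : ℝ) ^ 3 - k) * q ^ k / (2 * ν * (k : ℝ) ^ 2) with hCk
      -- termwise domination of the convolution on (0, ∞)
      have hconv : ∀ s, 0 < s → ∑ p ∈ antidiagonal k, e p.1 s * e p.2 s
          ≤ 24 * ν ^ 2 * ((k : ℝ) ^ 3 - k) * q ^ k := by
        intro s hs
        rw [← stationaryPole_conv ν q k]
        refine sum_le_sum fun p hp => ?_
        have hsum : p.1 + p.2 = k := mem_antidiagonal.mp hp
        rcases Nat.eq_zero_or_pos p.1 with h1 | h1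
        · rw [h1, he.zero]; simp
        rcases Nat.eq_zero_or_pos p.2 with h2 | h2
        · rw [h2, he.zero]; simp
        exact mul_le_mul (ih p.1 (by omega) s hs.le) (ih p.2 (by omega) s hs.le) (nonneg he hc _ s hs.le)
          (by positivity)
      have hanti : AntitoneOn (fun s => exp (ν * (k : ℝ) ^ 2 * s) * e k s - Ck * exp (ν * (k : ℝ) ^ 2 * s)) (Ici 0) := by
        refine antitoneOn_of_hasDerivWithinAt_nonpos
          (f' := fun s => exp (ν * (k : ℝ) ^ 2 * s) * ((1 / 2) * ∑ p ∈ antidiagonal k, e p.1 s * e p.2 s)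
            - Ck * (exp (ν * (k : ℝ) ^ 2 * s) * (ν * (k : ℝ) ^ 2)))
          (convex_Ici 0) ?_ (fun s hs => ?_) (fun s hs => ?_)
        · exact (continuousOn_weighted he k).sub
            ((continuous_const.mul (continuous_exp.comp (continuous_const.mul continuous_id))).continuousOn)
        · rw [interior_Ici] at hs ⊢
          have h2 : HasDerivAt (fun s => Ck * exp (ν * (k : ℝ) ^ 2 * s))
              (Ck * (exp (ν * (k : ℝ) ^ 2 * s) * (ν * (k : ℝ) ^ 2))) s := by
            have := ((hasDerivAt_id s).const_mul (ν * (k : ℝ) ^ 2)).exp.const_mul Ck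
            simpa using this
          exact ((hasDerivAt_weighted he k hs).sub h2).hasDerivWithinAt
        · rw [interior_Ici] at hs
          have hE : 0 < exp (ν * (k : ℝ) ^ 2 * s) := exp_pos _
          have hc' := hconv s hs
          have hid : Ck * (exp (ν * (k : ℝ) ^ 2 * s) * (ν * (k : ℝ) ^ 2))
              = exp (ν * (k : ℝ) ^ 2 * s) * ((1 / 2) * (24 * ν ^ 2 * ((k : ℝ) ^ 3 - k) * q ^ k)) := by
            rw [hCk]; field_simp
          rw [hid, ← mul_sub, ← mul_sub]
          have : (1 / 2) * ((∑ p ∈ antidiagonal k, e p.1 s * e p.2 s) - 24 * ν ^ 2 * ((k : ℝ) ^ 3 - k) * q ^ k) ≤ 0 := by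
            linarith
          exact mul_nonpos_iff.mpr (Or.inl ⟨hE.le, this⟩)
      have h := hanti (self_mem_Ici) ht ht
      simp only [mul_zero, exp_zero, mul_one, he.init_zero k hk, zero_sub] at h
      -- h : e^{νk²t} e_k t − Ck e^{νk²t} ≤ −Ck  ⇒  e_k t ≤ Ck (1 − e^{−νk²t}) ≤ Ck ≤ U_k
      have hE : 0 < exp (ν * (k : ℝ) ^ 2 * t) := exp_pos _
      have hCk0 : 0 ≤ Ck := by
        rw [hCk]
        have : 0 ≤ (k : ℝ) ^ 3 - k := by
          have h1 : (1 : ℝ) ≤ k := by exact_mod_cast (show 1 ≤ k by omega)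
          nlinarith
        positivity
      have hek : e k t ≤ Ck := by
        have h1 : exp (ν * (k : ℝ) ^ 2 * t) * e k t ≤ Ck * exp (ν * (k : ℝ) ^ 2 * t) - Ck := by linarith
        have h2 : Ck * exp (ν * (k : ℝ) ^ 2 * t) - Ck ≤ Ck * exp (ν * (k : ℝ) ^ 2 * t) := by linarith
        exact le_of_mul_le_mul_left (by linarith [mul_comm Ck (exp (ν * (k : ℝ) ^ 2 * t))]) hE
      refine le_trans hek ?_
      -- Ck = 12ν k q^k (1 − 1/k²) ≤ 12 ν k q^k
      rw [hCk, div_le_iff₀ (by positivity)]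
      have hqk : 0 ≤ q ^ k := pow_nonneg hq0 k
      nlinarith [mul_nonneg (mul_nonneg (by positivity : (0:ℝ) ≤ 24 * ν ^ 2) hk0.le) hqk]

/-- **GLOBAL FOR `c < 12ν` (uniform Wiener bound).** If `0 ≤ c < 12ν` then for every `K` and `t ≥ 0`:
`Σ_{k≤K} c_k(t) ≤ 144ν²c/(12ν − c)²` (`= 12ν·q/(1−q)²`, `q = c/(12ν)`, the first moment of the geometric series).
[new here — MODEL] -/
theorem partialSum_le_stationaryPole (he : IsSineCascade ν c e) (hν : 0 < ν) (hc : 0 ≤ c) (hsmall : c < 12 * ν)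
    (K : ℕ) (t : ℝ) (ht : 0 ≤ t) :
    ∑ k ∈ range (K + 1), e k t ≤ 144 * ν ^ 2 * c / (12 * ν - c) ^ 2 := by
  set q : ℝ := c / (12 * ν) with hq
  have hq0 : 0 ≤ q := div_nonneg hc (by positivity)
  have hq1 : q < 1 := by rw [hq, div_lt_one (by positivity)]; linarith
  have hterm : ∀ k ∈ range (K + 1), e k t ≤ 12 * ν * ((k : ℝ) * q ^ k) := by
    intro k _
    have := mode_le_stationaryPole he hν hc k t ht
    simpa [hq, mul_assoc] using this
  have hsum : HasSum (fun n : ℕ => (n : ℝ) * q ^ n) (q / (1 - q) ^ 2) :=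
    hasSum_coe_mul_geometric_of_norm_lt_one (by rwa [norm_of_nonneg hq0])
  have hpart : ∑ k ∈ range (K + 1), (k : ℝ) * q ^ k ≤ q / (1 - q) ^ 2 := by
    rw [← hsum.tsum_eq]
    exact hsum.summable.sum_le_tsum (range (K + 1)) (fun k _ => by positivity)
  calc ∑ k ∈ range (K + 1), e k t ≤ ∑ k ∈ range (K + 1), 12 * ν * ((k : ℝ) * q ^ k) := sum_le_sum hterm
    _ = 12 * ν * ∑ k ∈ range (K + 1), (k : ℝ) * q ^ k := by rw [mul_sum]
    _ ≤ 12 * ν * (q / (1 - q) ^ 2) := mul_le_mul_of_nonneg_left hpart (by positivity)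
    _ = 144 * ν ^ 2 * c / (12 * ν - c) ^ 2 := by
      rw [hq]
      have h1 : 12 * ν - c ≠ 0 := by linarith
      have h2 : (12 * ν) ≠ 0 := by positivity
      field_simp
      ring

end SheetNSLineTorusCascade
end Summit.NavierStokesRegularity.OSWSelfSimilar
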